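import Summits.ABC.IUTFork.Conditional.HexDepthLocalType
import Summits.ABC.IUTFork.Cor312GenuineKLocalTypeEven
import HarnessLib

/-!
# Branch C / R-W «GENUINE-NEG» at the k-PARITY TYPE `e ∣ 15·l` (EVEN `k`) — UNCONDITIONAL: the HEX datum `λ_k = 1/2 + 2/7^k` is decided on the
# refuted side for every EVEN `k ≥ 10` at every prime `11 ≤ l ≤ 137`, for every EVEN `k ≥ 8` at `l = 19`, and for every EVEN `k ≥ 12` at every
# prime `29 ≤ l ≤ 953`

PROOF-ONLY file (0 definitions, 0 `Prop` facts, no instance, no notation) of the abc-iut cell (seat abc-iut-w4-d087, gen 6; D-0079 rescue sub-cell R-W,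
lane P−, CLAIM «W:HEX:k-even» = the «k-parity / exact Tate type» row of abc-iut-w5-d163's HANDOFF 2026-08-26T18:13Z; plan g9 GO 18:42:10Z). TAKES
NO SIDE on [IUTchIII] Cor. 3.12 (S. Mochizuki, *Inter-universal Teichmüller theory III*, RIMS manuscript, Cor. 3.12 p. 173–174, Step (xi-f) p. 184)
or on any author.

INPUT (one application each; nothing restated): this seat's k-parity local type at `7` — `GenuineK.absRamificationIdx_kOf_le_fifteen_mul_lamSeven`
(`Cor312GenuineKLocalTypeEven`, on `Cor22.ramificationIdx_subThetaField_dvd_fifteen`: for EVEN `k` the Legendre curve of `λ_k` is MULTIPLICATIVE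
at `7` over `ℚ` and inertia fixes `√−1, √λ_k, √(λ_k−1)`, so `e(v|7) ∣ 15` and `e(x₀|v) ∣ l`): **`e(K_{x₀}/ℚ_7) ≤ 15·l` at every place `x₀ | 7`**
of a genuine Θ-volume datum over `(ratPoint λ_k, l)`. Fed into abc-iut-W-neg-2's engines `GenuineK.exists_deep_place_lamSeven_of_ramification_le` /
`GenuineK.not_pilotKummerCompatHull_lamSeven_of_ramification_le` (`HexDepthLocalType`, p458737; budget `n + 6/5 − 1/e`, criterion
`15·l < 6·7ⁿ ∧ l((l+1)(10n+12)+20) ≤ 5k(l−3)(l+1)`) with the windows `n = 2 ⇔ l ≤ 19`, `n = 3 ⇔ l ≤ 137`, `n = 4 ⇔ l ≤ 960`: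

* §1 `HexLocalType.exists_window_even` (`k ≥ 10`, prime `11 ≤ l ≤ 137`: `18l² ≥ 152l + 150` on `11…19`, `8l² ≥ 162l + 150` on `23…137`),
  `…_even_nineteen` (`k ≥ 8`, `l = 19`: `12540 ≤ 12800`), `…_even_twelve` (`k ≥ 12`, `29 ≤ l ≤ 953`: `8l² ≥ 192l + 180`);
* §2 `HexLocalType.exists_deep_place_lamSeven_even` / **`HexLocalType.not_pilotKummerCompatHull_lamSeven_even`** — EVEN `k ≥ 10`, every prime
  `11 ≤ l ≤ 137`;
* §3 `…_even_nineteen` — EVEN `k ≥ 8` at `l = 19` (the first kernel HEX class with `k = 8`);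
* §4 `…_even_twelve` — EVEN `k ≥ 12`, every prime `29 ≤ l ≤ 953`.
NEW CLASSES vs the `e ∣ 30·l` frontier of record (abc-iut-W-neg-2 `HexDepthLocalTypeThirty` p462253: `12 @ l ∈ {11,13}`, `11 @ 17 ≤ l ≤ 480`,
`10 @ 23 ≤ l ≤ 67`, `9 @ {53,59,61,67}`, `≥ 13 @ l ≤ 3361`): **`(10,11) · (10,13) · (10,17) · (10,19) · (8,19)`**, `(10, l)` for every prime
`71 ≤ l ≤ 137`, and `(12, l)` for every prime `487 ≤ l ≤ 953` — for EVEN `k` the kernel HEX frontier at `l ∈ {11, 13, 17}` reads `10`, at `l = 19`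
reads `8`. What stays WINDOW for this engine: odd `k ≤ 11` at `l ≤ 13` (no parity gain; `(11,13)` is abc-iut-W-neg-2's «SOME» row), every `k ≤ 6`,
`k = 8` off `l = 19` (e.g. `(8,11)`: `4444 > 3840`).

HONEST SCOPE: SHARP reading; the per-label licence is a STRONGER-THAN-PRINT sufficient form of (xi-f); a deep top-label packet says NOTHING about the
printed GLOBAL inequality, the number-level `Cor22.Cor312AtDatum`, or any author's intended hull; HEX rows are Szpiro-GOOD (abc-iut-c312-d1): they
test the WINDOW binder `hSHw` of the uncut records per datum and consume no hypothesis of the Szpiro-bad cut certificates; admissibility `CondP6` of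
`(λ_k, l)` is NOT asserted (the theorems hold at every datum `T`); typed ≠ proved; refuted-as-typed ≠ refuted-in-print; no abc claim.
[cite: Mochizuki2012, IUTchIII Cor. 3.12 Step (xi-f) p. 184; IUTchIV Prop. 1.2 p. 10, Prop. 1.8 (vi)–(vii) p. 19, Thm. 1.10 Steps (ii)–(iii) p. 24–26]
[cite: SilvermanAEC2009, proof of Prop. VII.5.4(c), Case 3] [cite: SerreLocalFields1979, Ch. III §6 Prop. 13] [claim: Mochizuki2012, status: disputed]
for every IUT quotation.
-/

noncomputable section

open Set Function NumberField IsDedekindDomain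

namespace Summit.ABC.IUTFork.Conditional.HexLocalType

open Thm311 Thm311.Real Cor312 Cor312Vol Cor312Prov Literature.IUT.LogThetaLattice Literature.IUT.LogVolume
  Literature.IUT.HodgeTheaters Literature.IUT.LogVolume.ThetaData
  Literature.NumberTheory.NumberFields Literature.NumberTheory.DiophantineGeometry.GenEll
  Literature.NumberTheory.DiophantineGeometry Summit.ABC.ABC.Theorems

/-! ## §1. The windows of the p458737 criterion at `E = 15·l` -/

/-- **The criterion at `E = 15·l`, every `k ≥ 10`, every `11 ≤ l ≤ 137`**: `n = 2` for `l ≤ 19` (`15·19 = 285 < 294`; at `k = 10`: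
`18l² ≥ 152l + 150`), `n = 3` for prime `23 ≤ l ≤ 137` (`15·137 = 2055 < 2058`; at `k = 10`: `8l² ≥ 162l + 150`, true from `l ≥ 22`); larger `k` by
monotonicity. [folklore] -/
theorem exists_window_even {k l : ℕ} (hk : 10 ≤ k) (hl : l.Prime) (h11 : 11 ≤ l) (h137 : l ≤ 137) :
    ∃ n : ℕ, 15 * l < 6 * 7 ^ n ∧ l * ((l + 1) * (10 * n + 12) + 20) ≤ 5 * k * ((l - 3) * (l + 1)) := by
  have h3 : 3 ≤ l := by omega
  have hmono : ∀ n : ℕ, l * ((l + 1) * (10 * n + 12) + 20) ≤ 5 * 10 * ((l - 3) * (l + 1)) →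
      l * ((l + 1) * (10 * n + 12) + 20) ≤ 5 * k * ((l - 3) * (l + 1)) := fun n h =>
    h.trans (Nat.mul_le_mul_right _ (Nat.mul_le_mul_left _ hk))
  by_cases h19 : l ≤ 19
  · refine ⟨2, by omega, hmono 2 ?_⟩
    zify [h3]
    have h11' : (11 : ℤ) ≤ (l : ℤ) := by exact_mod_cast h11
    nlinarith [mul_nonneg (sub_nonneg.mpr h11') (by positivity : (0 : ℤ) ≤ 18 * (l : ℤ) + 46)]
  · -- `l` prime and `20 ≤ l` force `23 ≤ l` (the polynomial condition holds from `l ≥ 22`)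
    have h23 : 23 ≤ l := by
      by_contra h
      interval_cases l <;> norm_num at hl
    refine ⟨3, by omega, hmono 3 ?_⟩
    zify [h3]
    have h23' : (23 : ℤ) ≤ (l : ℤ) := by exact_mod_cast h23
    nlinarith [mul_nonneg (sub_nonneg.mpr h23') (by positivity : (0 : ℤ) ≤ 8 * (l : ℤ) + 22)]

/-- **The criterion at `E = 285 = 15·19`, `l = 19`, every `k ≥ 8`**: `n = 2`, `19·(20·32 + 20) = 12540 ≤ 12800 = 5·8·16·20`. [folklore] -/
theorem window_even_nineteen {k : ℕ} (hk : 8 ≤ k) :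
    15 * 19 < 6 * 7 ^ 2 ∧ 19 * ((19 + 1) * (10 * 2 + 12) + 20) ≤ 5 * k * ((19 - 3) * (19 + 1)) := by
  refine ⟨by norm_num, ?_⟩
  have h : 19 * ((19 + 1) * (10 * 2 + 12) + 20) ≤ 5 * 8 * ((19 - 3) * (19 + 1)) := by norm_num
  exact h.trans (Nat.mul_le_mul_right _ (Nat.mul_le_mul_left _ hk))

/-- **The criterion at `E = 15·l`, every `k ≥ 12`, every `29 ≤ l ≤ 953`**: `n = 4` (`15·953 = 14295 < 14406`; at `k = 12`: `8l² ≥ 192l + 180`,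
true from `l ≥ 25`). [folklore] -/
theorem exists_window_even_twelve {k l : ℕ} (hk : 12 ≤ k) (h29 : 29 ≤ l) (h953 : l ≤ 953) :
    ∃ n : ℕ, 15 * l < 6 * 7 ^ n ∧ l * ((l + 1) * (10 * n + 12) + 20) ≤ 5 * k * ((l - 3) * (l + 1)) := by
  have h3 : 3 ≤ l := by omega
  refine ⟨4, by omega, ?_⟩
  have hk' : 5 * 12 * ((l - 3) * (l + 1)) ≤ 5 * k * ((l - 3) * (l + 1)) :=
    Nat.mul_le_mul_right _ (Nat.mul_le_mul_left _ hk)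
  refine le_trans ?_ hk'
  zify [h3]
  have h29' : (29 : ℤ) ≤ (l : ℤ) := by exact_mod_cast h29
  nlinarith [mul_nonneg (sub_nonneg.mpr h29') (by positivity : (0 : ℤ) ≤ 8 * (l : ℤ) + 40)]

/-! ## §2. EVEN `k ≥ 10`, every prime `11 ≤ l ≤ 137` -/

/-- **GENUINE-NEG at the k-parity type (depth form), UNCONDITIONAL: every EVEN `k ≥ 10`, every prime `11 ≤ l ≤ 137`.** At EVERY genuine Θ-volume
datum `T` over `(ratPoint λ_k, l)` the top label over `7` is deep at the CHOSEN realising q-idele — `GenuineK.exists_deep_place_lamSeven_of_ramification_le`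
at `E := 15·l` (`GenuineK.absRamificationIdx_kOf_le_fifteen_mul_lamSeven`) with the window of `exists_window_even`. New kernel classes: `(10,11)`,
`(10,13)`, `(10,17)`, `(10,19)`, `(10, 71…137)`. [cite: Mochizuki2012, IUTchIII Cor. 3.12 Step (xi-f) p. 184; IUTchIV Prop. 1.2 p. 10] [claim: Mochizuki2012, status: disputed] -/
theorem exists_deep_place_lamSeven_even {k l : ℕ} (heven : Even k) (hk : 10 ≤ k) (hl : l.Prime) (h11 : 11 ≤ l) (h137 : l ≤ 137)
    (T : Cor22.ThetaVolumeDatumAt (ratPoint ((2 : ℚ)⁻¹ + 2 / 7 ^ k)) l) :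
    letI := T.instFieldF; letI := T.instNumberFieldF; letI := T.instAlgebraF; letI := T.instFieldK
    letI := T.instNumberFieldK; letI := T.instAlgebraK; letI := T.instFieldFbar; letI := T.instAlgebraFbar
    letI := T.instAlgebraKFbar; letI := T.instIsElliptic
    haveI : Fact (Nat.Prime 7) := ⟨by norm_num⟩
    ∃ (i : Fin (thetaIndex (pilotDataOfK T.D T.K)).lstar) (x₀ : (thetaIndex (pilotDataOfK T.D T.K)).Fibre (.inr ⟨7, by norm_num⟩)),
      (i : ℕ) = (l - 1) / 2 - 1 ∧
      placeOf (pilotDataOfK T.D T.K) 7 x₀ ∈ (pilotDataOfK T.D T.K).S ∧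
      (7 : ℝ) ^ ((((i : ℕ) : ℝ) + 2) * (differentOrd 7 (kOf (pilotDataOfK T.D T.K) 7 x₀)
          + logRadiusA 7 (absRamificationIdx 7 (kOf (pilotDataOfK T.D T.K) 7 x₀))
          + logRadiusB 7 (absRamificationIdx 7 (kOf (pilotDataOfK T.D T.K) 7 x₀))) + 1) *
        ‖(exists_realising_qIdeles_pilotDataOfK T.D).choose ⟨7, by norm_num⟩ x₀‖ ^ (((i : ℕ) + 1) ^ 2 - 1) < 1  := by
  obtain ⟨n, hn, hkl⟩ := exists_window_even hk hl h11 h137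
  exact GenuineK.exists_deep_place_lamSeven_of_ramification_le (E := 15 * l) (by omega) hl h11 hn hkl T
    (GenuineK.absRamificationIdx_kOf_le_fifteen_mul_lamSeven (by omega) heven h11 T)

/-- **GENUINE-NEG at the k-parity type, UNCONDITIONAL: S_H FAILS at every datum over `(λ_k, l)` for every EVEN `k ≥ 10` and every prime
`11 ≤ l ≤ 137`** — every choice of the free context binders and Kummer data; CHOSEN realising ideles, PINNED reading (the per-datum instance of `hSHw` of
`abc_of_SH_v10K_window`). [cite: Mochizuki2012, IUTchIII Cor. 3.12 Step (xi-f) p. 184] [claim: Mochizuki2012, status: disputed] -/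
theorem not_pilotKummerCompatHull_lamSeven_even {k l : ℕ} (heven : Even k) (hk : 10 ≤ k) (hl : l.Prime) (h11 : 11 ≤ l) (h137 : l ≤ 137)
    (T : Cor22.ThetaVolumeDatumAt (ratPoint ((2 : ℚ)⁻¹ + 2 / 7 ^ k)) l) :
    letI := T.instFieldF; letI := T.instNumberFieldF; letI := T.instAlgebraF; letI := T.instFieldK
    letI := T.instNumberFieldK; letI := T.instAlgebraK; letI := T.instFieldFbar; letI := T.instAlgebraFbar
    letI := T.instAlgebraKFbar; letI := T.instIsElliptic
    ∀ (M : Type) [Field M] [NumberField M]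
      (archPk : ∀ (j : (thetaIndex (pilotDataOfK T.D T.K)).Label) (vQ : (thetaIndex (pilotDataOfK T.D T.K)).VQ),
        Set ((logShellsDH (pilotDataOfK T.D T.K) (analyticLogv T.K)).Packet j vQ))
      (archSub : ∀ (j : (thetaIndex (pilotDataOfK T.D T.K)).Label) (v : (thetaIndex (pilotDataOfK T.D T.K)).V),
        Set ((logShellsDH (pilotDataOfK T.D T.K) (analyticLogv T.K)).Packet j ((thetaIndex (pilotDataOfK T.D T.K)).over v)))
      (Ψ : ℤ → ∀ v : (thetaIndex (pilotDataOfK T.D T.K)).V, v ∈ (thetaIndex (pilotDataOfK T.D T.K)).Vbad →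
        Set ((logShellsDH (pilotDataOfK T.D T.K) (analyticLogv T.K)).StarPacket v))
      (act : ℤ → ∀ v : (thetaIndex (pilotDataOfK T.D T.K)).V, v ∈ (thetaIndex (pilotDataOfK T.D T.K)).Vbad →
        (logShellsDH (pilotDataOfK T.D T.K) (analyticLogv T.K)).StarPacket v →
          Module.End ℚ ((logShellsDH (pilotDataOfK T.D T.K) (analyticLogv T.K)).StarPacket v))
      (Mmod : ℤ → ∀ j : (thetaIndex (pilotDataOfK T.D T.K)).LabelStar,
        Set ((logShellsDH (pilotDataOfK T.D T.K) (analyticLogv T.K)).GlobalPacket j.1))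
      (region : ℤ → ∀ j : (thetaIndex (pilotDataOfK T.D T.K)).LabelStar, FinDivisor M →
        ∀ vQ : (thetaIndex (pilotDataOfK T.D T.K)).VQ, Set ((logShellsDH (pilotDataOfK T.D T.K) (analyticLogv T.K)).Packet j.1 vQ))
      (frobAdm : ℤ → ℤ → ∀ (j : (thetaIndex (pilotDataOfK T.D T.K)).Label) (vQ : (thetaIndex (pilotDataOfK T.D T.K)).VQ),
        Set ((logShellsDH (pilotDataOfK T.D T.K) (analyticLogv T.K)).Packet j vQ) → Prop)
      (frobLogvol : ℤ → ℤ → ∀ (j : (thetaIndex (pilotDataOfK T.D T.K)).Label) (vQ : (thetaIndex (pilotDataOfK T.D T.K)).VQ),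
        Set ((logShellsDH (pilotDataOfK T.D T.K) (analyticLogv T.K)).Packet j vQ) → ℝ)
      (frobΨ : ℤ → ℤ → ∀ v : (thetaIndex (pilotDataOfK T.D T.K)).V, v ∈ (thetaIndex (pilotDataOfK T.D T.K)).Vbad →
        Set ((logShellsDH (pilotDataOfK T.D T.K) (analyticLogv T.K)).StarPacket v))
      (frobMmod : ℤ → ℤ → ∀ j : (thetaIndex (pilotDataOfK T.D T.K)).LabelStar,
        Set ((logShellsDH (pilotDataOfK T.D T.K) (analyticLogv T.K)).GlobalPacket j.1))
      (unitImage : ℤ → ℤ → ℕ → ∀ (j : (thetaIndex (pilotDataOfK T.D T.K)).Label) (vQ : (thetaIndex (pilotDataOfK T.D T.K)).VQ),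
        Set ((logShellsDH (pilotDataOfK T.D T.K) (analyticLogv T.K)).Packet j vQ))
      (ballImage : ℤ → ℤ → ∀ (j : (thetaIndex (pilotDataOfK T.D T.K)).Label) (vQ : (thetaIndex (pilotDataOfK T.D T.K)).VQ),
        Set ((logShellsDH (pilotDataOfK T.D T.K) (analyticLogv T.K)).Packet j vQ))
      (thetaDiv : ℤ → ℤ → LgpDivisor M (thetaIndex (pilotDataOfK T.D T.K)).lstar)
      (n : ℤ) {HT : Type} {LogLink : HT → HT → Type} {IsFull : ∀ {s t : HT}, LogLink s t → Prop}
      (lat : LGPGaussianLogThetaLattice LogLink IsFull)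
      {Frd : Type} {IsoF : Frd → Frd → Type} {Ob : Frd → Type} {realify : Frd → Frd} {Strip : Type}
      {IsoS : Strip → Strip → Type} {Mv : ∀ v : (thetaIndex (pilotDataOfK T.D T.K)).V, v ∈ (thetaIndex (pilotDataOfK T.D T.K)).Vbad → Type}
      [∀ v h, Monoid (Mv v h)]
      (sig : GlobalLGPFrobenioidSignature (thetaIndex (pilotDataOfK T.D T.K)).lstar (thetaIndex (pilotDataOfK T.D T.K)).V
        (· ∈ (thetaIndex (pilotDataOfK T.D T.K)).Vbad) Frd IsoF Ob realify Strip IsoS Mv)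
      (split : SplittingMonoids Mv) {ObΔ : Type}
      {N : ∀ v : (thetaIndex (pilotDataOfK T.D T.K)).V, v ∈ (thetaIndex (pilotDataOfK T.D T.K)).Vbad → Type}
      [∀ v h, Monoid (N v h)] (qData : QPilotData ObΔ N)
      (qK : ∀ v : (thetaIndex (pilotDataOfK T.D T.K)).V, v ∈ (thetaIndex (pilotDataOfK T.D T.K)).Vbad →
        Set ((logShellsDH (pilotDataOfK T.D T.K) (analyticLogv T.K)).StarPacket v)),
    ¬ Cor312Vol.PilotKummerCompatHull
        (LatticeSituation.ofShells (logShellsDH (pilotDataOfK T.D T.K) (analyticLogv T.K)) M archPk archSub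
          (summandPiecesPr (pilotDataOfK T.D T.K) (logvAnalytic_analyticLogv (F := T.K))).Adm
          (summandPiecesPr (pilotDataOfK T.D T.K) (logvAnalytic_analyticLogv (F := T.K))).logvol Ψ act Mmod region frobAdm
          frobLogvol frobΨ frobMmod unitImage ballImage thetaDiv)
        (settingPrVolSharp (pilotDataOfK T.D T.K) (logvAnalytic_analyticLogv (F := T.K)) M archPk archSub Ψ act Mmod region n
          lat sig split qData (exists_realising_qIdeles_pilotDataOfK T.D).choose (exists_realising_thetaIdeles_pilotDataOfK T.D).choose
          (exists_realising_qIdeles_pilotDataOfK T.D).choose_spec.1 (exists_realising_qIdeles_pilotDataOfK T.D).choose_spec.2.1)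
        (fun _ => Cor312.Setting.qRegion
          (settingPrVolSharp (pilotDataOfK T.D T.K) (logvAnalytic_analyticLogv (F := T.K)) M archPk archSub Ψ act Mmod region n
            lat sig split qData (exists_realising_qIdeles_pilotDataOfK T.D).choose (exists_realising_thetaIdeles_pilotDataOfK T.D).choose
            (exists_realising_qIdeles_pilotDataOfK T.D).choose_spec.1 (exists_realising_qIdeles_pilotDataOfK T.D).choose_spec.2.1))
        qK := by
  obtain ⟨n, hn, hkl⟩ := exists_window_even hk hl h11 h137
  exact GenuineK.not_pilotKummerCompatHull_lamSeven_of_ramification_le (E := 15 * l) (by omega) hl h11 hn hkl T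
    (GenuineK.absRamificationIdx_kOf_le_fifteen_mul_lamSeven (by omega) heven h11 T)

/-! ## §3. EVEN `k ≥ 8` at `l = 19`: the first kernel HEX class with `k = 8` -/

/-- **GENUINE-NEG at the k-parity type (depth form), UNCONDITIONAL: every EVEN `k ≥ 8` at `l = 19`** (`E = 285 < 294`, `n = 2`, `12540 ≤ 12800`).
New kernel class: `(8, 19)`. [cite: Mochizuki2012, IUTchIII Cor. 3.12 Step (xi-f) p. 184; IUTchIV Prop. 1.2 p. 10] [claim: Mochizuki2012, status: disputed] -/
theorem exists_deep_place_lamSeven_even_nineteen {k : ℕ} (heven : Even k) (hk : 8 ≤ k)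
    (T : Cor22.ThetaVolumeDatumAt (ratPoint ((2 : ℚ)⁻¹ + 2 / 7 ^ k)) 19) :
    letI := T.instFieldF; letI := T.instNumberFieldF; letI := T.instAlgebraF; letI := T.instFieldK
    letI := T.instNumberFieldK; letI := T.instAlgebraK; letI := T.instFieldFbar; letI := T.instAlgebraFbar
    letI := T.instAlgebraKFbar; letI := T.instIsElliptic
    haveI : Fact (Nat.Prime 7) := ⟨by norm_num⟩
    ∃ (i : Fin (thetaIndex (pilotDataOfK T.D T.K)).lstar) (x₀ : (thetaIndex (pilotDataOfK T.D T.K)).Fibre (.inr ⟨7, by norm_num⟩)),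
      (i : ℕ) = (19 - 1) / 2 - 1 ∧
      placeOf (pilotDataOfK T.D T.K) 7 x₀ ∈ (pilotDataOfK T.D T.K).S ∧
      (7 : ℝ) ^ ((((i : ℕ) : ℝ) + 2) * (differentOrd 7 (kOf (pilotDataOfK T.D T.K) 7 x₀)
          + logRadiusA 7 (absRamificationIdx 7 (kOf (pilotDataOfK T.D T.K) 7 x₀))
          + logRadiusB 7 (absRamificationIdx 7 (kOf (pilotDataOfK T.D T.K) 7 x₀))) + 1) *
        ‖(exists_realising_qIdeles_pilotDataOfK T.D).choose ⟨7, by norm_num⟩ x₀‖ ^ (((i : ℕ) + 1) ^ 2 - 1) < 1  := by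
  obtain ⟨hn, hkl⟩ := window_even_nineteen hk
  exact GenuineK.exists_deep_place_lamSeven_of_ramification_le (E := 15 * 19) (by omega) (by norm_num) (by norm_num) hn hkl T
    (GenuineK.absRamificationIdx_kOf_le_fifteen_mul_lamSeven (by omega) heven (by norm_num) T)

/-- **GENUINE-NEG at the k-parity type, UNCONDITIONAL: S_H FAILS at every datum over `(λ_k, 19)` for every EVEN `k ≥ 8`** — every choice of the
free context binders and Kummer data; CHOSEN realising ideles, PINNED reading. [cite: Mochizuki2012, IUTchIII Cor. 3.12 Step (xi-f) p. 184] [claim: Mochizuki2012, status: disputed] -/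
theorem not_pilotKummerCompatHull_lamSeven_even_nineteen {k : ℕ} (heven : Even k) (hk : 8 ≤ k)
    (T : Cor22.ThetaVolumeDatumAt (ratPoint ((2 : ℚ)⁻¹ + 2 / 7 ^ k)) 19) :
    letI := T.instFieldF; letI := T.instNumberFieldF; letI := T.instAlgebraF; letI := T.instFieldK
    letI := T.instNumberFieldK; letI := T.instAlgebraK; letI := T.instFieldFbar; letI := T.instAlgebraFbar
    letI := T.instAlgebraKFbar; letI := T.instIsElliptic
    ∀ (M : Type) [Field M] [NumberField M]
      (archPk : ∀ (j : (thetaIndex (pilotDataOfK T.D T.K)).Label) (vQ : (thetaIndex (pilotDataOfK T.D T.K)).VQ),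
        Set ((logShellsDH (pilotDataOfK T.D T.K) (analyticLogv T.K)).Packet j vQ))
      (archSub : ∀ (j : (thetaIndex (pilotDataOfK T.D T.K)).Label) (v : (thetaIndex (pilotDataOfK T.D T.K)).V),
        Set ((logShellsDH (pilotDataOfK T.D T.K) (analyticLogv T.K)).Packet j ((thetaIndex (pilotDataOfK T.D T.K)).over v)))
      (Ψ : ℤ → ∀ v : (thetaIndex (pilotDataOfK T.D T.K)).V, v ∈ (thetaIndex (pilotDataOfK T.D T.K)).Vbad →
        Set ((logShellsDH (pilotDataOfK T.D T.K) (analyticLogv T.K)).StarPacket v))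
      (act : ℤ → ∀ v : (thetaIndex (pilotDataOfK T.D T.K)).V, v ∈ (thetaIndex (pilotDataOfK T.D T.K)).Vbad →
        (logShellsDH (pilotDataOfK T.D T.K) (analyticLogv T.K)).StarPacket v →
          Module.End ℚ ((logShellsDH (pilotDataOfK T.D T.K) (analyticLogv T.K)).StarPacket v))
      (Mmod : ℤ → ∀ j : (thetaIndex (pilotDataOfK T.D T.K)).LabelStar,
        Set ((logShellsDH (pilotDataOfK T.D T.K) (analyticLogv T.K)).GlobalPacket j.1))
      (region : ℤ → ∀ j : (thetaIndex (pilotDataOfK T.D T.K)).LabelStar, FinDivisor M →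
        ∀ vQ : (thetaIndex (pilotDataOfK T.D T.K)).VQ, Set ((logShellsDH (pilotDataOfK T.D T.K) (analyticLogv T.K)).Packet j.1 vQ))
      (frobAdm : ℤ → ℤ → ∀ (j : (thetaIndex (pilotDataOfK T.D T.K)).Label) (vQ : (thetaIndex (pilotDataOfK T.D T.K)).VQ),
        Set ((logShellsDH (pilotDataOfK T.D T.K) (analyticLogv T.K)).Packet j vQ) → Prop)
      (frobLogvol : ℤ → ℤ → ∀ (j : (thetaIndex (pilotDataOfK T.D T.K)).Label) (vQ : (thetaIndex (pilotDataOfK T.D T.K)).VQ),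
        Set ((logShellsDH (pilotDataOfK T.D T.K) (analyticLogv T.K)).Packet j vQ) → ℝ)
      (frobΨ : ℤ → ℤ → ∀ v : (thetaIndex (pilotDataOfK T.D T.K)).V, v ∈ (thetaIndex (pilotDataOfK T.D T.K)).Vbad →
        Set ((logShellsDH (pilotDataOfK T.D T.K) (analyticLogv T.K)).StarPacket v))
      (frobMmod : ℤ → ℤ → ∀ j : (thetaIndex (pilotDataOfK T.D T.K)).LabelStar,
        Set ((logShellsDH (pilotDataOfK T.D T.K) (analyticLogv T.K)).GlobalPacket j.1))
      (unitImage : ℤ → ℤ → ℕ → ∀ (j : (thetaIndex (pilotDataOfK T.D T.K)).Label) (vQ : (thetaIndex (pilotDataOfK T.D T.K)).VQ),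
        Set ((logShellsDH (pilotDataOfK T.D T.K) (analyticLogv T.K)).Packet j vQ))
      (ballImage : ℤ → ℤ → ∀ (j : (thetaIndex (pilotDataOfK T.D T.K)).Label) (vQ : (thetaIndex (pilotDataOfK T.D T.K)).VQ),
        Set ((logShellsDH (pilotDataOfK T.D T.K) (analyticLogv T.K)).Packet j vQ))
      (thetaDiv : ℤ → ℤ → LgpDivisor M (thetaIndex (pilotDataOfK T.D T.K)).lstar)
      (n : ℤ) {HT : Type} {LogLink : HT → HT → Type} {IsFull : ∀ {s t : HT}, LogLink s t → Prop}
      (lat : LGPGaussianLogThetaLattice LogLink IsFull)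
      {Frd : Type} {IsoF : Frd → Frd → Type} {Ob : Frd → Type} {realify : Frd → Frd} {Strip : Type}
      {IsoS : Strip → Strip → Type} {Mv : ∀ v : (thetaIndex (pilotDataOfK T.D T.K)).V, v ∈ (thetaIndex (pilotDataOfK T.D T.K)).Vbad → Type}
      [∀ v h, Monoid (Mv v h)]
      (sig : GlobalLGPFrobenioidSignature (thetaIndex (pilotDataOfK T.D T.K)).lstar (thetaIndex (pilotDataOfK T.D T.K)).V
        (· ∈ (thetaIndex (pilotDataOfK T.D T.K)).Vbad) Frd IsoF Ob realify Strip IsoS Mv)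
      (split : SplittingMonoids Mv) {ObΔ : Type}
      {N : ∀ v : (thetaIndex (pilotDataOfK T.D T.K)).V, v ∈ (thetaIndex (pilotDataOfK T.D T.K)).Vbad → Type}
      [∀ v h, Monoid (N v h)] (qData : QPilotData ObΔ N)
      (qK : ∀ v : (thetaIndex (pilotDataOfK T.D T.K)).V, v ∈ (thetaIndex (pilotDataOfK T.D T.K)).Vbad →
        Set ((logShellsDH (pilotDataOfK T.D T.K) (analyticLogv T.K)).StarPacket v)),
    ¬ Cor312Vol.PilotKummerCompatHull
        (LatticeSituation.ofShells (logShellsDH (pilotDataOfK T.D T.K) (analyticLogv T.K)) M archPk archSub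
          (summandPiecesPr (pilotDataOfK T.D T.K) (logvAnalytic_analyticLogv (F := T.K))).Adm
          (summandPiecesPr (pilotDataOfK T.D T.K) (logvAnalytic_analyticLogv (F := T.K))).logvol Ψ act Mmod region frobAdm
          frobLogvol frobΨ frobMmod unitImage ballImage thetaDiv)
        (settingPrVolSharp (pilotDataOfK T.D T.K) (logvAnalytic_analyticLogv (F := T.K)) M archPk archSub Ψ act Mmod region n
          lat sig split qData (exists_realising_qIdeles_pilotDataOfK T.D).choose (exists_realising_thetaIdeles_pilotDataOfK T.D).choose
          (exists_realising_qIdeles_pilotDataOfK T.D).choose_spec.1 (exists_realising_qIdeles_pilotDataOfK T.D).choose_spec.2.1)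
        (fun _ => Cor312.Setting.qRegion
          (settingPrVolSharp (pilotDataOfK T.D T.K) (logvAnalytic_analyticLogv (F := T.K)) M archPk archSub Ψ act Mmod region n
            lat sig split qData (exists_realising_qIdeles_pilotDataOfK T.D).choose (exists_realising_thetaIdeles_pilotDataOfK T.D).choose
            (exists_realising_qIdeles_pilotDataOfK T.D).choose_spec.1 (exists_realising_qIdeles_pilotDataOfK T.D).choose_spec.2.1))
        qK := by
  obtain ⟨hn, hkl⟩ := window_even_nineteen hk
  exact GenuineK.not_pilotKummerCompatHull_lamSeven_of_ramification_le (E := 15 * 19) (by omega) (by norm_num) (by norm_num) hn hkl T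
    (GenuineK.absRamificationIdx_kOf_le_fifteen_mul_lamSeven (by omega) heven (by norm_num) T)

/-! ## §4. EVEN `k ≥ 12`, every prime `29 ≤ l ≤ 953` -/

/-- **GENUINE-NEG at the k-parity type (depth form), UNCONDITIONAL: every EVEN `k ≥ 12`, every prime `29 ≤ l ≤ 953`** (`n = 4`). New kernel classes
vs the `∣ 30·l` frontier (`12 @ l ≤ 480`): `(12, l)` for every prime `487 ≤ l ≤ 953`. [cite: Mochizuki2012, IUTchIII Cor. 3.12 Step (xi-f) p. 184; IUTchIV Prop. 1.2 p. 10]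
[claim: Mochizuki2012, status: disputed] -/
theorem exists_deep_place_lamSeven_even_twelve {k l : ℕ} (heven : Even k) (hk : 12 ≤ k) (hl : l.Prime) (h29 : 29 ≤ l) (h953 : l ≤ 953)
    (T : Cor22.ThetaVolumeDatumAt (ratPoint ((2 : ℚ)⁻¹ + 2 / 7 ^ k)) l) :
    letI := T.instFieldF; letI := T.instNumberFieldF; letI := T.instAlgebraF; letI := T.instFieldK
    letI := T.instNumberFieldK; letI := T.instAlgebraK; letI := T.instFieldFbar; letI := T.instAlgebraFbar
    letI := T.instAlgebraKFbar; letI := T.instIsElliptic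
    haveI : Fact (Nat.Prime 7) := ⟨by norm_num⟩
    ∃ (i : Fin (thetaIndex (pilotDataOfK T.D T.K)).lstar) (x₀ : (thetaIndex (pilotDataOfK T.D T.K)).Fibre (.inr ⟨7, by norm_num⟩)),
      (i : ℕ) = (l - 1) / 2 - 1 ∧
      placeOf (pilotDataOfK T.D T.K) 7 x₀ ∈ (pilotDataOfK T.D T.K).S ∧
      (7 : ℝ) ^ ((((i : ℕ) : ℝ) + 2) * (differentOrd 7 (kOf (pilotDataOfK T.D T.K) 7 x₀)
          + logRadiusA 7 (absRamificationIdx 7 (kOf (pilotDataOfK T.D T.K) 7 x₀))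
          + logRadiusB 7 (absRamificationIdx 7 (kOf (pilotDataOfK T.D T.K) 7 x₀))) + 1) *
        ‖(exists_realising_qIdeles_pilotDataOfK T.D).choose ⟨7, by norm_num⟩ x₀‖ ^ (((i : ℕ) + 1) ^ 2 - 1) < 1  := by
  obtain ⟨n, hn, hkl⟩ := exists_window_even_twelve hk h29 h953
  exact GenuineK.exists_deep_place_lamSeven_of_ramification_le (E := 15 * l) (by omega) hl (by omega) hn hkl T
    (GenuineK.absRamificationIdx_kOf_le_fifteen_mul_lamSeven (by omega) heven (by omega) T)

/-- **GENUINE-NEG at the k-parity type, UNCONDITIONAL: S_H FAILS at every datum over `(λ_k, l)` for every EVEN `k ≥ 12` and every prime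
`29 ≤ l ≤ 953`** — every choice of the free context binders and Kummer data; CHOSEN realising ideles, PINNED reading.
[cite: Mochizuki2012, IUTchIII Cor. 3.12 Step (xi-f) p. 184] [claim: Mochizuki2012, status: disputed] -/
theorem not_pilotKummerCompatHull_lamSeven_even_twelve {k l : ℕ} (heven : Even k) (hk : 12 ≤ k) (hl : l.Prime) (h29 : 29 ≤ l)
    (h953 : l ≤ 953) (T : Cor22.ThetaVolumeDatumAt (ratPoint ((2 : ℚ)⁻¹ + 2 / 7 ^ k)) l) :
    letI := T.instFieldF; letI := T.instNumberFieldF; letI := T.instAlgebraF; letI := T.instFieldK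
    letI := T.instNumberFieldK; letI := T.instAlgebraK; letI := T.instFieldFbar; letI := T.instAlgebraFbar
    letI := T.instAlgebraKFbar; letI := T.instIsElliptic
    ∀ (M : Type) [Field M] [NumberField M]
      (archPk : ∀ (j : (thetaIndex (pilotDataOfK T.D T.K)).Label) (vQ : (thetaIndex (pilotDataOfK T.D T.K)).VQ),
        Set ((logShellsDH (pilotDataOfK T.D T.K) (analyticLogv T.K)).Packet j vQ))
      (archSub : ∀ (j : (thetaIndex (pilotDataOfK T.D T.K)).Label) (v : (thetaIndex (pilotDataOfK T.D T.K)).V),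
        Set ((logShellsDH (pilotDataOfK T.D T.K) (analyticLogv T.K)).Packet j ((thetaIndex (pilotDataOfK T.D T.K)).over v)))
      (Ψ : ℤ → ∀ v : (thetaIndex (pilotDataOfK T.D T.K)).V, v ∈ (thetaIndex (pilotDataOfK T.D T.K)).Vbad →
        Set ((logShellsDH (pilotDataOfK T.D T.K) (analyticLogv T.K)).StarPacket v))
      (act : ℤ → ∀ v : (thetaIndex (pilotDataOfK T.D T.K)).V, v ∈ (thetaIndex (pilotDataOfK T.D T.K)).Vbad →
        (logShellsDH (pilotDataOfK T.D T.K) (analyticLogv T.K)).StarPacket v →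
          Module.End ℚ ((logShellsDH (pilotDataOfK T.D T.K) (analyticLogv T.K)).StarPacket v))
      (Mmod : ℤ → ∀ j : (thetaIndex (pilotDataOfK T.D T.K)).LabelStar,
        Set ((logShellsDH (pilotDataOfK T.D T.K) (analyticLogv T.K)).GlobalPacket j.1))
      (region : ℤ → ∀ j : (thetaIndex (pilotDataOfK T.D T.K)).LabelStar, FinDivisor M →
        ∀ vQ : (thetaIndex (pilotDataOfK T.D T.K)).VQ, Set ((logShellsDH (pilotDataOfK T.D T.K) (analyticLogv T.K)).Packet j.1 vQ))
      (frobAdm : ℤ → ℤ → ∀ (j : (thetaIndex (pilotDataOfK T.D T.K)).Label) (vQ : (thetaIndex (pilotDataOfK T.D T.K)).VQ),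
        Set ((logShellsDH (pilotDataOfK T.D T.K) (analyticLogv T.K)).Packet j vQ) → Prop)
      (frobLogvol : ℤ → ℤ → ∀ (j : (thetaIndex (pilotDataOfK T.D T.K)).Label) (vQ : (thetaIndex (pilotDataOfK T.D T.K)).VQ),
        Set ((logShellsDH (pilotDataOfK T.D T.K) (analyticLogv T.K)).Packet j vQ) → ℝ)
      (frobΨ : ℤ → ℤ → ∀ v : (thetaIndex (pilotDataOfK T.D T.K)).V, v ∈ (thetaIndex (pilotDataOfK T.D T.K)).Vbad →
        Set ((logShellsDH (pilotDataOfK T.D T.K) (analyticLogv T.K)).StarPacket v))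
      (frobMmod : ℤ → ℤ → ∀ j : (thetaIndex (pilotDataOfK T.D T.K)).LabelStar,
        Set ((logShellsDH (pilotDataOfK T.D T.K) (analyticLogv T.K)).GlobalPacket j.1))
      (unitImage : ℤ → ℤ → ℕ → ∀ (j : (thetaIndex (pilotDataOfK T.D T.K)).Label) (vQ : (thetaIndex (pilotDataOfK T.D T.K)).VQ),
        Set ((logShellsDH (pilotDataOfK T.D T.K) (analyticLogv T.K)).Packet j vQ))
      (ballImage : ℤ → ℤ → ∀ (j : (thetaIndex (pilotDataOfK T.D T.K)).Label) (vQ : (thetaIndex (pilotDataOfK T.D T.K)).VQ),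
        Set ((logShellsDH (pilotDataOfK T.D T.K) (analyticLogv T.K)).Packet j vQ))
      (thetaDiv : ℤ → ℤ → LgpDivisor M (thetaIndex (pilotDataOfK T.D T.K)).lstar)
      (n : ℤ) {HT : Type} {LogLink : HT → HT → Type} {IsFull : ∀ {s t : HT}, LogLink s t → Prop}
      (lat : LGPGaussianLogThetaLattice LogLink IsFull)
      {Frd : Type} {IsoF : Frd → Frd → Type} {Ob : Frd → Type} {realify : Frd → Frd} {Strip : Type}
      {IsoS : Strip → Strip → Type} {Mv : ∀ v : (thetaIndex (pilotDataOfK T.D T.K)).V, v ∈ (thetaIndex (pilotDataOfK T.D T.K)).Vbad → Type}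
      [∀ v h, Monoid (Mv v h)]
      (sig : GlobalLGPFrobenioidSignature (thetaIndex (pilotDataOfK T.D T.K)).lstar (thetaIndex (pilotDataOfK T.D T.K)).V
        (· ∈ (thetaIndex (pilotDataOfK T.D T.K)).Vbad) Frd IsoF Ob realify Strip IsoS Mv)
      (split : SplittingMonoids Mv) {ObΔ : Type}
      {N : ∀ v : (thetaIndex (pilotDataOfK T.D T.K)).V, v ∈ (thetaIndex (pilotDataOfK T.D T.K)).Vbad → Type}
      [∀ v h, Monoid (N v h)] (qData : QPilotData ObΔ N)
      (qK : ∀ v : (thetaIndex (pilotDataOfK T.D T.K)).V, v ∈ (thetaIndex (pilotDataOfK T.D T.K)).Vbad →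
        Set ((logShellsDH (pilotDataOfK T.D T.K) (analyticLogv T.K)).StarPacket v)),
    ¬ Cor312Vol.PilotKummerCompatHull
        (LatticeSituation.ofShells (logShellsDH (pilotDataOfK T.D T.K) (analyticLogv T.K)) M archPk archSub
          (summandPiecesPr (pilotDataOfK T.D T.K) (logvAnalytic_analyticLogv (F := T.K))).Adm
          (summandPiecesPr (pilotDataOfK T.D T.K) (logvAnalytic_analyticLogv (F := T.K))).logvol Ψ act Mmod region frobAdm
          frobLogvol frobΨ frobMmod unitImage ballImage thetaDiv)
        (settingPrVolSharp (pilotDataOfK T.D T.K) (logvAnalytic_analyticLogv (F := T.K)) M archPk archSub Ψ act Mmod region n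
          lat sig split qData (exists_realising_qIdeles_pilotDataOfK T.D).choose (exists_realising_thetaIdeles_pilotDataOfK T.D).choose
          (exists_realising_qIdeles_pilotDataOfK T.D).choose_spec.1 (exists_realising_qIdeles_pilotDataOfK T.D).choose_spec.2.1)
        (fun _ => Cor312.Setting.qRegion
          (settingPrVolSharp (pilotDataOfK T.D T.K) (logvAnalytic_analyticLogv (F := T.K)) M archPk archSub Ψ act Mmod region n
            lat sig split qData (exists_realising_qIdeles_pilotDataOfK T.D).choose (exists_realising_thetaIdeles_pilotDataOfK T.D).choose
            (exists_realising_qIdeles_pilotDataOfK T.D).choose_spec.1 (exists_realising_qIdeles_pilotDataOfK T.D).choose_spec.2.1))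
        qK := by
  obtain ⟨n, hn, hkl⟩ := exists_window_even_twelve hk h29 h953
  exact GenuineK.not_pilotKummerCompatHull_lamSeven_of_ramification_le (E := 15 * l) (by omega) hl (by omega) hn hkl T
    (GenuineK.absRamificationIdx_kOf_le_fifteen_mul_lamSeven (by omega) heven (by omega) T)

end Summit.ABC.IUTFork.Conditional.HexLocalType

end
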